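import Summits.QuantumFields.BalabanUV.Beta.EriceFlowEnclosureB12AsPrintedHistoryContagionShiftFlowZeroTangentLimit
import Summits.QuantumFields.BalabanUV.Beta.EriceFlowEnclosureB12AsPrintedHistoryContagionShiftFlowZeroOffset

/-!
# Beta / EriceFlowEnclosureB12AsPrintedHistoryContagionShiftFlowZeroTangentFlow — ASYMPTOTIC FREEDOM IS CONTAGIOUS, part 68: THE TANGENT FLOW OF THE FLOW WITH MEMORY,
# AND THE DIFFERENCE QUOTIENTS OF TWO SOLUTIONS.  FOR THE FLOW (`B` with memory profile `(C_m, θ)` on ]0, γ]^ℕ, ONE AF reference t, part 14's package at the reference pin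
# e′ — `hs1 hs2 hs4 hs5`) and a functional that is DIFFERENTIABLE ALONG THE HISTORY in the following DEF-FREE sense (explicit binders, NOT a node U2 interface; g41-Q1
# remains node U2's reading question): a GRADIENT `G : (ℕ → ℝ) → ℕ → ℝ` with the memory profile **`|G u j| ≤ C_m θ^j`** on the box (`hG`) and a UNIFORM FIRST-ORDER
# REMAINDER **`∀ ε > 0 ∃ ρ > 0: sup_j |u′_j − u_j| ≤ ρ ⟹ |B u′ − B u − Σ_j G u j (u′_j − u_j)| ≤ ε·Σ_j θ^j|u′_j − u_j|`** on the box (`hGB`).  (§112) At every pin e of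
# ]0, e′] THE solution `h = solution B e` carries THE TANGENT FLOW: the bounded solution W of part 66's linear memory equation with `c_{p,j} = G(h_{p+1+·}) j` (the gradient
# at the tails), `v_q = h_q³∕2` (the chart-to-coupling Jacobian), `s ≡ 1` — **`W_k = 1 − Σ_{p<k} Σ_j G(h_{p+1+·}) j · (h_{p+1+j}³∕2) · W_{p+1+j}`**, `|W| ≤ 2`, UNIQUE, and
# **`|W_k − 1| ≤ C_m(8e³ + 16e∕β*)∕(1−θ)`** (→ 0 with the pin: the tangent form of part 44's asymptotic isometry) — under `hG` alone.  (§113) For two pins e ≠ ẽ of ]0, e′] the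
# CHART QUOTIENTS **`D_q = (1∕h̃_q² − 1∕h_q²)∕(1∕ẽ² − 1∕e²) ∈ [2∕3, 4∕3]`** (part 14's two-pin kernel) of the two solutions SOLVE A LINEAR MEMORY EQUATION OF THE SAME SHAPE,
# EXACTLY: `v_q = μ_q = h_q²h̃_q²∕(h_q + h̃_q)` (`0 ≤ μ_q ≤ w_q∕2`, `|μ_q − h_q³∕2| ≤ (8∕3)e′²·w_q·|1∕ẽ² − 1∕e²|`) and source `1 + (Σ_{p<k} r_p)∕(1∕ẽ² − 1∕e²)`, `r_p` the
# first-order remainders of B between the two tails (`quotient_identity`) — so part 69 compares D with W by ONE application of part 66's `fixedPoint_perturb`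
# (β-flow team, prover 1, unit `b2b-balaban-beta-bflow-p1`, gen 42; ROW AP-I·Uc × NODE U2)

HONEST FRAMING (page 1 of everything the β sub-cell writes): discharging `BetaPertH` makes Bałaban's UV stability UNCONDITIONAL — a
real constructive-QFT result; it is NOT the continuum limit and NOT the Clay problem.  HONEST DEPENDENCY (cell reorg 2026-08-19,
verbatim): «continuum YM on T⁴ ⇐ BetaPertH ∧ nine spine estimates (0/9 proved); BetaPertH ⇐ (D1) ∧ (D4) ∧ CAP+tail; G-an2-4 gates
asym, D1 and NE2/3/4.»  THIS MODULE DISCHARGES NOTHING: [folklore] real analysis (parts 66–67's linear algebra; three-line algebra of difference quotients) over node U2's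
HYPOTHESIS SHAPES `T4BetaStationary.{SeqBox, MemoryProfile}`, `T4BetaFlowWellPosed.{MemFlow, drive, solution}` and part 13∕14's `solution` theory, consumed BY NAME — the
shapes node U2 derives from its NE4 ∕ history-moduli LETTERS (NOT PRINTED for [I] = T. Bałaban, Commun. Math. Phys. **109** (1987) [Balaban1987RG1]: p. 298 says only that
β_j depends on the preceding couplings; (0.20) p. 256; Theorem 2 (0.31) p. 259 STATED WITHOUT PROOF).  The C¹ shape `hG`∕`hGB` is OUR hypothesis, an explicit binder; whether
Bałaban's β_k (analytic in the couplings by construction, [I] §1) supplies it in the limit is NOT asserted.  Nothing of Bałaban's β is asserted.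

WHAT THIS FILE PROVES (0 sorry, 0 def): §112 `solution_facts`, `tangent_data`, `smallness_of_hs5`, **`tangent_exists`**, **`tangent_unique`**, **`tangent_sub_one_abs_le`**,
`tangent_pos`; §113 `quotient_mem_Icc`, `mu_facts`, `sub_eq_mu_mul`, `abs_mu_sub_cube_le`, **`quotient_identity`**.  NOT CLAIMED: the limit ẽ → e (part 69); anything
about Bałaban's β; `BetaPertH`; the continuum limit of the measures; Clay.
-/

namespace Summit.QuantumFields.BalabanUV.Beta.EriceFlowEnclosureB12AsPrintedHistoryContagionShiftFlowZeroTangentFlow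

open Finset Filter Topology Set
open Literature.MathematicalPhysics.QuantumFieldTheory.Balaban1983to89
open Literature.MathematicalPhysics.QuantumFieldTheory.Balaban1983to89.T4CouplingMatching (prof sprof sprof_pos sprof_sq prof_pos sprof_zero abs_sub_le_of_inv_sq)
open Literature.MathematicalPhysics.QuantumFieldTheory.Balaban1983to89.T4BetaStationary (SeqBox MemoryProfile summable_profile abs_sub_le_of_seqBox)
open Literature.MathematicalPhysics.QuantumFieldTheory.Balaban1983to89.T4BetaFlowWellPosed (MemFlow drive solution seqBox_shift invSq_eq_of_memFlow)
open Summit.QuantumFields.BalabanUV.Beta.EriceFlowEnclosureB12AsPrintedHistoryContagion (sprof_le_sprof)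
open Summit.QuantumFields.BalabanUV.Beta.EriceFlowEnclosureB12AsPrintedHistoryContagionShiftFlow (le_invSprof_of_prof_le)
open Summit.QuantumFields.BalabanUV.Beta.EriceFlowEnclosureB12AsPrintedHistoryContagionShiftFlowPicardLimit (memFlow_solution_of_reference)
open Summit.QuantumFields.BalabanUV.Beta.EriceFlowEnclosureB12AsPrintedHistoryContagionShiftFlowPicardPin (sep_twoSided_solution)
open Summit.QuantumFields.BalabanUV.Beta.EriceFlowEnclosureB12AsPrintedHistoryContagionShiftFlowZeroOffset (package_of_le)
open Summit.QuantumFields.BalabanUV.Beta.EriceFlowEnclosureB12AsPrintedHistoryContagionShiftFlowZeroTangent (row_summable_abs_le kernel_abs_le abs_term_le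
  term_summable fixedPoint_exists fixedPoint_unique)
open Summit.QuantumFields.BalabanUV.Beta.EriceFlowEnclosureB12AsPrintedHistoryContagionShiftFlowZeroTangentLimit (profWeight_nonneg profWeight_anti
  sum_profWeight_le)

noncomputable section

/-! ## §112 The tangent flow at every pin of the small box -/

/-- **THE SOLUTION AT A PIN OF THE SMALL BOX** (part 13's package slid down from e′ by part 42's `package_of_le`): `solution B e` is a box solution from e with the quarter
profile from 2e, below node U2's AF coupling profile `(1∕(4e′²) + (β*∕4)q)^{−1∕2}` at base 2e′, below 2e, and its cube is below the AF weight at base 2e′.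
[cite: Balaban1987RG1, Thm 2 (0.31) p.259 with (0.20) p.256] -/
theorem solution_facts {B : (ℕ → ℝ) → ℝ} {Cm θ γ bs ta gs e' : ℝ} {t : ℕ → ℝ}
    (hB : MemoryProfile Cm θ γ B) (hCm : 0 ≤ Cm) (hθ0 : 0 ≤ θ) (hθ1 : θ < 1) (hbs : 0 < bs) (hta : 0 < ta)
    (hts : SeqBox γ t) (htf : MemFlow B gs t) (hprof : ∀ m : ℕ, 1 / ta ^ 2 + bs * (m : ℝ) ≤ 1 / (t m) ^ 2)
    (h2e' : 2 * e' ≤ γ) (hs1 : 4 * Cm * e' ≤ bs * (1 - θ))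
    (hs2 : e' ^ 2 * (1 / gs ^ 2 + Cm * γ / (1 - θ) ^ 2 + (2 * Cm / ((1 - θ) * bs)) ^ 2) ≤ 3 / 4)
    (hs4 : 64 * Cm * e' ^ 3 ≤ (1 - θ) ^ 2) (hs5 : Cm * (8 * e' ^ 3 + 16 * e' / bs) ≤ (1 - θ) / 4) {e : ℝ} (he : e ∈ Ioc (0 : ℝ) e') :
    SeqBox γ (solution B e) ∧ MemFlow B e (solution B e) ∧
      (∀ q : ℕ, 1 / (4 * e ^ 2) + bs / 4 * (q : ℝ) ≤ 1 / (solution B e q) ^ 2) ∧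
      (∀ q : ℕ, solution B e q ≤ 1 / sprof (2 * e') (bs / 4) q) ∧ (∀ q : ℕ, solution B e q ≤ 2 * e) ∧
      ∀ q : ℕ, (solution B e q) ^ 3 ≤ 1 / (sprof (2 * e') (bs / 4) q) ^ 2 * (1 / sprof (2 * e') (bs / 4) q) := by
  have he' : 0 < e' := he.1.trans_le he.2
  have h1θ : 0 < 1 - θ := by linarith
  have hγ : 0 ≤ γ := by linarith
  obtain ⟨hs1e, hs2e, hs4e, -⟩ := package_of_le (gs := gs) hCm hθ1 hbs hγ he.1 he.2 hs1 hs2 hs4 hs5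
  have h2e : 2 * e ≤ γ := by linarith [he.2]
  obtain ⟨hsb, hsf, hq, -⟩ := memFlow_solution_of_reference hB hCm hθ0 hθ1 hbs hta hts htf hprof he.1 h2e hs1e hs2e hs4e
  have h2e'0 : 0 < 2 * e' := by positivity
  have hb4 : 0 ≤ bs / 4 := by positivity
  have hle : ∀ q : ℕ, solution B e q ≤ 1 / sprof (2 * e') (bs / 4) q := fun q => by
    refine le_invSprof_of_prof_le h2e'0 hb4 (hsb q).1 ?_
    have h1 : 1 / (2 * e') ^ 2 ≤ 1 / (4 * e ^ 2) := by
      rw [show (2 * e') ^ 2 = 4 * e' ^ 2 by ring]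
      exact one_div_le_one_div_of_le (by have := he.1; positivity) (by nlinarith [he.1, he.2])
    linarith [hq q]
  refine ⟨hsb, hsf, hq, hle, fun q => ?_, fun q => ?_⟩
  · have hq0 := hq q
    have hpos := (hsb q).1
    have h4 : 1 / (4 * e ^ 2) ≤ 1 / (solution B e q) ^ 2 := by
      have : 0 ≤ bs / 4 * (q : ℝ) := by positivity
      linarith
    have h4e : (0 : ℝ) < 4 * e ^ 2 := by have := he.1; positivity
    have hsq : (solution B e q) ^ 2 ≤ 4 * e ^ 2 := (one_div_le_one_div h4e (pow_pos hpos 2)).mp h4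
    nlinarith [he.1, hpos]
  · have hp := sprof_pos h2e'0 hb4 q
    calc (solution B e q) ^ 3 ≤ (1 / sprof (2 * e') (bs / 4) q) ^ 3 := pow_le_pow_left₀ (hsb q).1.le (hle q) 3
      _ = 1 / (sprof (2 * e') (bs / 4) q) ^ 2 * (1 / sprof (2 * e') (bs / 4) q) := by ring

/-- THE DATA OF THE TANGENT FLOW SATISFY PART 66's STANDING BOUNDS: under the gradient profile `|G u j| ≤ C_mθ^j` on the box, the coefficients `c_{p,j} = G(h_{p+1+·}) j` at the
tails of a box solution obey `|c_{p,j}| ≤ C_mθ^j`, and the Jacobian `h_q³∕2` is below half the AF weight. [folklore] -/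
theorem tangent_data {B : (ℕ → ℝ) → ℝ} {G : (ℕ → ℝ) → ℕ → ℝ} {Cm θ γ bs e' : ℝ} {h : ℕ → ℝ}
    (hG : ∀ u : ℕ → ℝ, SeqBox γ u → ∀ j, |G u j| ≤ Cm * θ ^ j) (hhs : SeqBox γ h)
    (hcube : ∀ q : ℕ, (h q) ^ 3 ≤ 1 / (sprof (2 * e') (bs / 4) q) ^ 2 * (1 / sprof (2 * e') (bs / 4) q)) :
    (∀ p j : ℕ, |G (fun i => h (p + 1 + i)) j| ≤ Cm * θ ^ j) ∧
      ∀ q : ℕ, |(h q) ^ 3 / 2| ≤ 1 / (sprof (2 * e') (bs / 4) q) ^ 2 * (1 / sprof (2 * e') (bs / 4) q) / 2 := by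
  have _hB := B
  refine ⟨fun p j => hG _ (seqBox_shift hhs (p + 1)) j, fun q => ?_⟩
  rw [abs_of_nonneg (by have := (hhs q).1; positivity)]
  linarith [hcube q]

/-- Part 14's `hs5` IS part 66's smallness: `C_m(8e′³ + 16e′∕β*) ≤ (1−θ)∕4` ⟹ `C_mS∕(2(1−θ)) ≤ 1∕8 ≤ 1∕2`. [folklore] -/
theorem smallness_of_hs5 {Cm θ bs e' : ℝ} (hθ1 : θ < 1) (hs5 : Cm * (8 * e' ^ 3 + 16 * e' / bs) ≤ (1 - θ) / 4) :
    Cm * (8 * e' ^ 3 + 16 * e' / bs) / (2 * (1 - θ)) ≤ 1 / 8 ∧ Cm * (8 * e' ^ 3 + 16 * e' / bs) / (2 * (1 - θ)) ≤ 1 / 2 ∧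
      Cm * (8 * e' ^ 3 + 16 * e' / bs) / (1 - θ) ≤ 1 / 4 := by
  have h1θ : 0 < 1 - θ := by linarith
  have h1 : Cm * (8 * e' ^ 3 + 16 * e' / bs) / (2 * (1 - θ)) ≤ 1 / 8 := by
    rw [div_le_iff₀ (by positivity)]; linarith
  have h3 : Cm * (8 * e' ^ 3 + 16 * e' / bs) / (1 - θ) ≤ 1 / 4 := by
    rw [div_le_iff₀ h1θ]; linarith
  exact ⟨h1, by linarith, h3⟩

/-- **THE TANGENT FLOW EXISTS AT EVERY PIN OF THE SMALL BOX.**  Part 14's package at e′, a gradient profile `|G u j| ≤ C_mθ^j` on the box, `e ∈ ]0, e′]`, `h = solution B e`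
⟹ there is W with **`W_k = 1 − Σ_{p<k} Σ_j G(h_{p+1+·}) j · (h_{p+1+j}³∕2) · W_{p+1+j}`** for every k and `|W_k| ≤ 2` (part 66's `fixedPoint_exists` with the AF weights at base 2e′).
The remainder letter of B is NOT needed here: the tangent flow is an object of the gradient alone. [cite: Balaban1987RG1, Thm 2 (0.31) p.259 with (0.20) p.256 and p.298] -/
theorem tangent_exists {B : (ℕ → ℝ) → ℝ} {G : (ℕ → ℝ) → ℕ → ℝ} {Cm θ γ bs ta gs e' : ℝ} {t : ℕ → ℝ}
    (hB : MemoryProfile Cm θ γ B) (hCm : 0 ≤ Cm) (hθ0 : 0 ≤ θ) (hθ1 : θ < 1) (hbs : 0 < bs) (hta : 0 < ta)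
    (hts : SeqBox γ t) (htf : MemFlow B gs t) (hprof : ∀ m : ℕ, 1 / ta ^ 2 + bs * (m : ℝ) ≤ 1 / (t m) ^ 2)
    (hG : ∀ u : ℕ → ℝ, SeqBox γ u → ∀ j, |G u j| ≤ Cm * θ ^ j)
    (h2e' : 2 * e' ≤ γ) (hs1 : 4 * Cm * e' ≤ bs * (1 - θ))
    (hs2 : e' ^ 2 * (1 / gs ^ 2 + Cm * γ / (1 - θ) ^ 2 + (2 * Cm / ((1 - θ) * bs)) ^ 2) ≤ 3 / 4)
    (hs4 : 64 * Cm * e' ^ 3 ≤ (1 - θ) ^ 2) (hs5 : Cm * (8 * e' ^ 3 + 16 * e' / bs) ≤ (1 - θ) / 4) {e : ℝ} (he : e ∈ Ioc (0 : ℝ) e') :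
    ∃ W : ℕ → ℝ, (∀ k, W k = 1 - ∑ p ∈ range k, ∑' j,
        G (fun i => solution B e (p + 1 + i)) j * ((solution B e (p + 1 + j)) ^ 3 / 2) * W (p + 1 + j)) ∧ ∀ k, |W k| ≤ 2 := by
  have he' : 0 < e' := he.1.trans_le he.2
  obtain ⟨hsb, -, -, -, -, hcube⟩ := solution_facts hB hCm hθ0 hθ1 hbs hta hts htf hprof h2e' hs1 hs2 hs4 hs5 he
  obtain ⟨hc, hv⟩ := tangent_data (B := B) (e' := e') hG hsb hcube
  obtain ⟨-, hq, -⟩ := smallness_of_hs5 (Cm := Cm) (bs := bs) (e' := e') hθ1 hs5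
  obtain ⟨W, hW, hWb⟩ := fixedPoint_exists (s := fun _ => (1 : ℝ)) (σ := 1) hCm hθ0 hθ1 (profWeight_nonneg hbs he')
    (fun hab => profWeight_anti hbs he' hab) (sum_profWeight_le hbs he') hc hv (fun k => by simp) hq
  exact ⟨W, hW, fun k => by linarith [hWb k]⟩

/-- **THE TANGENT FLOW IS UNIQUE** among bounded sequences (part 66's `fixedPoint_unique`). [cite: Balaban1987RG1, Thm 2 (0.31) p.259 with (0.20) p.256 and p.298] -/
theorem tangent_unique {B : (ℕ → ℝ) → ℝ} {G : (ℕ → ℝ) → ℕ → ℝ} {Cm θ γ bs ta gs e' M M' : ℝ} {t W W' : ℕ → ℝ}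
    (hB : MemoryProfile Cm θ γ B) (hCm : 0 ≤ Cm) (hθ0 : 0 ≤ θ) (hθ1 : θ < 1) (hbs : 0 < bs) (hta : 0 < ta)
    (hts : SeqBox γ t) (htf : MemFlow B gs t) (hprof : ∀ m : ℕ, 1 / ta ^ 2 + bs * (m : ℝ) ≤ 1 / (t m) ^ 2)
    (hG : ∀ u : ℕ → ℝ, SeqBox γ u → ∀ j, |G u j| ≤ Cm * θ ^ j)
    (h2e' : 2 * e' ≤ γ) (hs1 : 4 * Cm * e' ≤ bs * (1 - θ))
    (hs2 : e' ^ 2 * (1 / gs ^ 2 + Cm * γ / (1 - θ) ^ 2 + (2 * Cm / ((1 - θ) * bs)) ^ 2) ≤ 3 / 4)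
    (hs4 : 64 * Cm * e' ^ 3 ≤ (1 - θ) ^ 2) (hs5 : Cm * (8 * e' ^ 3 + 16 * e' / bs) ≤ (1 - θ) / 4) {e : ℝ} (he : e ∈ Ioc (0 : ℝ) e')
    (hW : ∀ k, W k = 1 - ∑ p ∈ range k, ∑' j, G (fun i => solution B e (p + 1 + i)) j * ((solution B e (p + 1 + j)) ^ 3 / 2) * W (p + 1 + j))
    (hWM : ∀ k, |W k| ≤ M)
    (hW' : ∀ k, W' k = 1 - ∑ p ∈ range k, ∑' j, G (fun i => solution B e (p + 1 + i)) j * ((solution B e (p + 1 + j)) ^ 3 / 2) * W' (p + 1 + j))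
    (hWM' : ∀ k, |W' k| ≤ M') : W = W' := by
  have he' : 0 < e' := he.1.trans_le he.2
  obtain ⟨hsb, -, -, -, -, hcube⟩ := solution_facts hB hCm hθ0 hθ1 hbs hta hts htf hprof h2e' hs1 hs2 hs4 hs5 he
  obtain ⟨hc, hv⟩ := tangent_data (B := B) (e' := e') hG hsb hcube
  obtain ⟨-, hq, -⟩ := smallness_of_hs5 (Cm := Cm) (bs := bs) (e' := e') hθ1 hs5
  exact fixedPoint_unique (s := fun _ => (1 : ℝ)) hCm hθ0 hθ1 (profWeight_nonneg hbs he') (fun hab => profWeight_anti hbs he' hab)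
    (sum_profWeight_le hbs he') hq hc hv hW hWM hW' hWM'

/-- **THE TANGENT FLOW IS 1 + O(e)**: `|W_k − 1| ≤ C_m(8e³ + 16e∕β*)∕(1−θ)` at every scale — the AF weights AT THE PIN's OWN BASE 2e also dominate the Jacobian, and their sum
is `8e³ + 16e∕β*`; with `|W| ≤ 2` the kernel gives the bound (part 44's asymptotic chart-isometry in TANGENT form: `∂(1∕h_k²)∕∂(1∕e²) → 1` as e → 0, uniformly in k).  In
particular `3∕4 ≤ W_k ≤ 5∕4`. [cite: Balaban1987RG1, Thm 2 (0.31) p.259 with (0.20) p.256 and p.298] -/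
theorem tangent_sub_one_abs_le {B : (ℕ → ℝ) → ℝ} {G : (ℕ → ℝ) → ℕ → ℝ} {Cm θ γ bs ta gs e' : ℝ} {t W : ℕ → ℝ}
    (hB : MemoryProfile Cm θ γ B) (hCm : 0 ≤ Cm) (hθ0 : 0 ≤ θ) (hθ1 : θ < 1) (hbs : 0 < bs) (hta : 0 < ta)
    (hts : SeqBox γ t) (htf : MemFlow B gs t) (hprof : ∀ m : ℕ, 1 / ta ^ 2 + bs * (m : ℝ) ≤ 1 / (t m) ^ 2)
    (hG : ∀ u : ℕ → ℝ, SeqBox γ u → ∀ j, |G u j| ≤ Cm * θ ^ j)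
    (h2e' : 2 * e' ≤ γ) (hs1 : 4 * Cm * e' ≤ bs * (1 - θ))
    (hs2 : e' ^ 2 * (1 / gs ^ 2 + Cm * γ / (1 - θ) ^ 2 + (2 * Cm / ((1 - θ) * bs)) ^ 2) ≤ 3 / 4)
    (hs4 : 64 * Cm * e' ^ 3 ≤ (1 - θ) ^ 2) (hs5 : Cm * (8 * e' ^ 3 + 16 * e' / bs) ≤ (1 - θ) / 4) {e : ℝ} (he : e ∈ Ioc (0 : ℝ) e')
    (hW : ∀ k, W k = 1 - ∑ p ∈ range k, ∑' j, G (fun i => solution B e (p + 1 + i)) j * ((solution B e (p + 1 + j)) ^ 3 / 2) * W (p + 1 + j))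
    (hWM : ∀ k, |W k| ≤ 2) (k : ℕ) :
    |W k - 1| ≤ Cm * (8 * e ^ 3 + 16 * e / bs) / (1 - θ) ∧ 3 / 4 ≤ W k ∧ W k ≤ 5 / 4 := by
  have he' : 0 < e' := he.1.trans_le he.2
  have h1θ : 0 < 1 - θ := by linarith
  have hγ : 0 ≤ γ := by linarith
  -- the package at the pin e itself: the solution is below the AF profile at base 2e
  obtain ⟨hs1e, hs2e, hs4e, hs5e⟩ := package_of_le (gs := gs) hCm hθ1 hbs hγ he.1 he.2 hs1 hs2 hs4 hs5
  have hee : e ∈ Ioc (0 : ℝ) e := ⟨he.1, le_rfl⟩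
  have h2e : 2 * e ≤ γ := by linarith [he.2]
  obtain ⟨hsb, -, -, -, -, hcube⟩ := solution_facts hB hCm hθ0 hθ1 hbs hta hts htf hprof h2e hs1e hs2e hs4e hs5e hee
  obtain ⟨hc, hv⟩ := tangent_data (B := B) (e' := e) hG hsb hcube
  have hk := kernel_abs_le hθ0 hθ1 (profWeight_nonneg hbs he.1) (fun hab => profWeight_anti hbs he.1 hab) (sum_profWeight_le hbs he.1)
    (by norm_num : (0 : ℝ) ≤ 2 / 2) hCm (abs_term_le hCm hθ0 hc hv hWM) k
  have e1 : W k - 1 = -∑ p ∈ range k, ∑' j, G (fun i => solution B e (p + 1 + i)) j * ((solution B e (p + 1 + j)) ^ 3 / 2) * W (p + 1 + j) := by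
    rw [hW k]; ring
  rw [e1, abs_neg]
  have hb : Cm * (8 * e ^ 3 + 16 * e / bs) * (2 / 2) / (1 - θ) = Cm * (8 * e ^ 3 + 16 * e / bs) / (1 - θ) := by ring
  rw [hb] at hk
  have hq : Cm * (8 * e ^ 3 + 16 * e / bs) / (1 - θ) ≤ 1 / 4 := (smallness_of_hs5 (Cm := Cm) (bs := bs) (e' := e) hθ1 hs5e).2.2
  refine ⟨hk, ?_, ?_⟩ <;> linarith [(abs_le.mp (hk.trans hq)).1, (abs_le.mp (hk.trans hq)).2, e1]

/-- The tangent flow is POSITIVE at every scale (`W_k ≥ 3∕4`): the solution is strictly increasing in the pin to first order, uniformly in the scale.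
[cite: Balaban1987RG1, Thm 2 (0.31) p.259 with (0.20) p.256] -/
theorem tangent_pos {B : (ℕ → ℝ) → ℝ} {G : (ℕ → ℝ) → ℕ → ℝ} {Cm θ γ bs ta gs e' : ℝ} {t W : ℕ → ℝ}
    (hB : MemoryProfile Cm θ γ B) (hCm : 0 ≤ Cm) (hθ0 : 0 ≤ θ) (hθ1 : θ < 1) (hbs : 0 < bs) (hta : 0 < ta)
    (hts : SeqBox γ t) (htf : MemFlow B gs t) (hprof : ∀ m : ℕ, 1 / ta ^ 2 + bs * (m : ℝ) ≤ 1 / (t m) ^ 2)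
    (hG : ∀ u : ℕ → ℝ, SeqBox γ u → ∀ j, |G u j| ≤ Cm * θ ^ j)
    (h2e' : 2 * e' ≤ γ) (hs1 : 4 * Cm * e' ≤ bs * (1 - θ))
    (hs2 : e' ^ 2 * (1 / gs ^ 2 + Cm * γ / (1 - θ) ^ 2 + (2 * Cm / ((1 - θ) * bs)) ^ 2) ≤ 3 / 4)
    (hs4 : 64 * Cm * e' ^ 3 ≤ (1 - θ) ^ 2) (hs5 : Cm * (8 * e' ^ 3 + 16 * e' / bs) ≤ (1 - θ) / 4) {e : ℝ} (he : e ∈ Ioc (0 : ℝ) e')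
    (hW : ∀ k, W k = 1 - ∑ p ∈ range k, ∑' j, G (fun i => solution B e (p + 1 + i)) j * ((solution B e (p + 1 + j)) ^ 3 / 2) * W (p + 1 + j))
    (hWM : ∀ k, |W k| ≤ 2) (k : ℕ) : 0 < W k := by
  have h := (tangent_sub_one_abs_le hB hCm hθ0 hθ1 hbs hta hts htf hprof hG h2e' hs1 hs2 hs4 hs5 he hW hWM k).2.1
  linarith

/-! ## §113 Two pins: the chart quotients solve a linear memory equation of the same shape -/

/-- **THE CHART QUOTIENTS ARE IN [2∕3, 4∕3] AT EVERY SCALE** (part 14's two-pin kernel, either order of the pins): for e ≠ ẽ in ]0, e′],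
`D_q = (1∕h̃_q² − 1∕h_q²)∕(1∕ẽ² − 1∕e²) ∈ [2∕3, 4∕3]`, hence `|D_q| ≤ 4∕3`. [cite: Balaban1987RG1, Thm 2 (0.31) p.259 with (0.20) p.256 and p.298] -/
theorem quotient_mem_Icc {B : (ℕ → ℝ) → ℝ} {Cm θ γ bs ta gs e' : ℝ} {t : ℕ → ℝ}
    (hB : MemoryProfile Cm θ γ B) (hCm : 0 ≤ Cm) (hθ0 : 0 ≤ θ) (hθ1 : θ < 1) (hbs : 0 < bs) (hta : 0 < ta)
    (hts : SeqBox γ t) (htf : MemFlow B gs t) (hprof : ∀ m : ℕ, 1 / ta ^ 2 + bs * (m : ℝ) ≤ 1 / (t m) ^ 2)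
    (h2e' : 2 * e' ≤ γ) (hs1 : 4 * Cm * e' ≤ bs * (1 - θ))
    (hs2 : e' ^ 2 * (1 / gs ^ 2 + Cm * γ / (1 - θ) ^ 2 + (2 * Cm / ((1 - θ) * bs)) ^ 2) ≤ 3 / 4)
    (hs4 : 64 * Cm * e' ^ 3 ≤ (1 - θ) ^ 2) (hs5 : Cm * (8 * e' ^ 3 + 16 * e' / bs) ≤ (1 - θ) / 4)
    {e ee : ℝ} (he : e ∈ Ioc (0 : ℝ) e') (hee : ee ∈ Ioc (0 : ℝ) e') (hne : ee ≠ e) (q : ℕ) :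
    2 / 3 ≤ (1 / (solution B ee q) ^ 2 - 1 / (solution B e q) ^ 2) / (1 / ee ^ 2 - 1 / e ^ 2) ∧
      (1 / (solution B ee q) ^ 2 - 1 / (solution B e q) ^ 2) / (1 / ee ^ 2 - 1 / e ^ 2) ≤ 4 / 3 ∧
      |(1 / (solution B ee q) ^ 2 - 1 / (solution B e q) ^ 2) / (1 / ee ^ 2 - 1 / e ^ 2)| ≤ 4 / 3 := by
  have hγ : 0 ≤ γ := by linarith [he.1, he.2]
  have key : ∀ {a b : ℝ}, a ∈ Ioc (0 : ℝ) e' → b ∈ Ioc (0 : ℝ) e' → a < b →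
      2 / 3 ≤ (1 / (solution B a q) ^ 2 - 1 / (solution B b q) ^ 2) / (1 / a ^ 2 - 1 / b ^ 2) ∧
        (1 / (solution B a q) ^ 2 - 1 / (solution B b q) ^ 2) / (1 / a ^ 2 - 1 / b ^ 2) ≤ 4 / 3 := by
    intro a b ha hb hab
    obtain ⟨hs1b, hs2b, hs4b, hs5b⟩ := package_of_le (gs := gs) hCm hθ1 hbs hγ hb.1 hb.2 hs1 hs2 hs4 hs5
    have h2b : 2 * b ≤ γ := by linarith [hb.2]
    have hk := sep_twoSided_solution hB hCm hθ0 hθ1 hbs hta hts htf hprof ha.1 hab.le h2b hs1b hs2b hs4b hs5b q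
    have hΔ : 0 < 1 / a ^ 2 - 1 / b ^ 2 := by
      have := ha.1
      rw [sub_pos]; exact one_div_lt_one_div_of_lt (by positivity) (by nlinarith)
    obtain ⟨hlo, hhi⟩ := abs_le.mp hk
    constructor
    · rw [le_div_iff₀ hΔ]; linarith
    · rw [div_le_iff₀ hΔ]; linarith
  have main : 2 / 3 ≤ (1 / (solution B ee q) ^ 2 - 1 / (solution B e q) ^ 2) / (1 / ee ^ 2 - 1 / e ^ 2) ∧
      (1 / (solution B ee q) ^ 2 - 1 / (solution B e q) ^ 2) / (1 / ee ^ 2 - 1 / e ^ 2) ≤ 4 / 3 := by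
    rcases lt_or_gt_of_ne hne with hlt | hgt
    · exact key hee he hlt
    · have h := key he hee hgt
      rwa [show (1 / (solution B e q) ^ 2 - 1 / (solution B ee q) ^ 2) / (1 / e ^ 2 - 1 / ee ^ 2)
          = (1 / (solution B ee q) ^ 2 - 1 / (solution B e q) ^ 2) / (1 / ee ^ 2 - 1 / e ^ 2) by
        rw [← neg_sub (1 / (solution B ee q) ^ 2), ← neg_sub (1 / ee ^ 2), neg_div_neg_eq]] at h
  exact ⟨main.1, main.2, abs_le.mpr ⟨by linarith [main.1], main.2⟩⟩

/-- **THE MIXED JACOBIAN** `μ_q = h_q²h̃_q²∕(h_q + h̃_q)` of two solutions: `0 ≤ μ_q ≤ w_q∕2` (`2h²h̃² ≤ σ³(h + h̃)` for `h, h̃ ≤ σ = (1∕(4e′²) + (β*∕4)q)^{−1∕2}` — no mean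
inequality needed). [folklore] -/
theorem mu_facts {σ a b : ℝ} (ha : 0 < a) (hb : 0 < b) (haσ : a ≤ σ) (hbσ : b ≤ σ) :
    0 ≤ a ^ 2 * b ^ 2 / (a + b) ∧ |a ^ 2 * b ^ 2 / (a + b)| ≤ 1 / (1 / σ) ^ 2 * (1 / (1 / σ)) / 2 := by
  have hσ : 0 < σ := ha.trans_le haσ
  have h0 : 0 ≤ a ^ 2 * b ^ 2 / (a + b) := by positivity
  refine ⟨h0, ?_⟩
  rw [abs_of_nonneg h0, show 1 / (1 / σ) ^ 2 * (1 / (1 / σ)) / 2 = σ ^ 3 / 2 by field_simp, div_le_div_iff₀ (by positivity) (by norm_num)]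
  -- 2a²b² ≤ σ³(a + b):  a²b·b ≤ σ³ b and ab²·a ≤ σ³ a
  have h1 : a ^ 2 * b ≤ σ ^ 3 := by
    calc a ^ 2 * b ≤ σ ^ 2 * σ := mul_le_mul (pow_le_pow_left₀ ha.le haσ 2) hbσ hb.le (by positivity)
      _ = σ ^ 3 := by ring
  have h2 : a * b ^ 2 ≤ σ ^ 3 := by
    calc a * b ^ 2 ≤ σ * σ ^ 2 := mul_le_mul haσ (pow_le_pow_left₀ hb.le hbσ 2) (by positivity) hσ.le
      _ = σ ^ 3 := by ring
  nlinarith [mul_le_mul_of_nonneg_right h1 hb.le, mul_le_mul_of_nonneg_right h2 ha.le]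

/-- THE COUPLING DIFFERENCE THROUGH THE CHART DIFFERENCE: `h̃ − h = −(1∕h̃² − 1∕h²)·h²h̃²∕(h + h̃)` for positive h, h̃. [folklore] -/
theorem sub_eq_mu_mul {a b : ℝ} (ha : 0 < a) (hb : 0 < b) :
    b - a = -(1 / b ^ 2 - 1 / a ^ 2) * (a ^ 2 * b ^ 2 / (a + b)) := by
  have hab : a + b ≠ 0 := by positivity
  field_simp
  ring

/-- **THE MIXED JACOBIAN IS THE CUBE TO FIRST ORDER**: `|h²h̃²∕(h + h̃) − h³∕2| = h²|h̃ − h|(2h̃ + h)∕(2(h + h̃)) ≤ h²·|h̃ − h|`. [folklore] -/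
theorem abs_mu_sub_cube_le {a b : ℝ} (ha : 0 < a) (hb : 0 < b) :
    |a ^ 2 * b ^ 2 / (a + b) - a ^ 3 / 2| ≤ a ^ 2 * |b - a| := by
  have hab : 0 < a + b := by positivity
  have e : a ^ 2 * b ^ 2 / (a + b) - a ^ 3 / 2 = a ^ 2 * (b - a) * ((2 * b + a) / (2 * (a + b))) := by
    field_simp
    ring
  rw [e, abs_mul, abs_mul, abs_of_pos (pow_pos ha 2)]
  have hf : |(2 * b + a) / (2 * (a + b))| ≤ 1 := by
    rw [abs_of_pos (by positivity), div_le_one (by positivity)]; linarith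
  calc a ^ 2 * |b - a| * |(2 * b + a) / (2 * (a + b))| ≤ a ^ 2 * |b - a| * 1 :=
        mul_le_mul_of_nonneg_left hf (by positivity)
    _ = a ^ 2 * |b - a| := mul_one _

/-- **THE DIFFERENCE-QUOTIENT IDENTITY.**  `B` with a gradient profile `|G u j| ≤ C_mθ^j` on the box; two box solutions h (pin e) and h̃ (pin ẽ), `1∕ẽ² ≠ 1∕e²`, whose chart
quotients `D_q = (1∕h̃_q² − 1∕h_q²)∕(1∕ẽ² − 1∕e²)` are bounded.  THEN, EXACTLY, at every scale k:
**`D_k = (1 + (Σ_{p<k} r_p)∕(1∕ẽ² − 1∕e²)) − Σ_{p<k} Σ_j G(h_{p+1+·}) j · μ_{p+1+j} · D_{p+1+j}`**, `μ_q = h_q²h̃_q²∕(h_q + h̃_q)`,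
`r_p = B(h̃_{p+1+·}) − B(h_{p+1+·}) − Σ_j G(h_{p+1+·}) j (h̃_{p+1+j} − h_{p+1+j})` — the two flow equations subtracted (`invSq_eq_of_memFlow`), each memory increment split into
its linear part and its remainder, and `h̃ − h = −(1∕ẽ² − 1∕e²)·μ·D` termwise. [cite: Balaban1987RG1, (0.20) p.256 with p.298] -/
theorem quotient_identity {B : (ℕ → ℝ) → ℝ} {G : (ℕ → ℝ) → ℕ → ℝ} {Cm θ γ M e ee : ℝ} {w h hh : ℕ → ℝ}
    (hCm : 0 ≤ Cm) (hθ0 : 0 ≤ θ) (hθ1 : θ < 1)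
    (hG : ∀ u : ℕ → ℝ, SeqBox γ u → ∀ j, |G u j| ≤ Cm * θ ^ j)
    (hhs : SeqBox γ h) (hhf : MemFlow B e h) (hhhs : SeqBox γ hh) (hhhf : MemFlow B ee hh) (hne : 1 / ee ^ 2 - 1 / e ^ 2 ≠ 0)
    (hwanti : ∀ {a b : ℕ}, a ≤ b → w b ≤ w a) (hμ : ∀ q, |h q ^ 2 * hh q ^ 2 / (h q + hh q)| ≤ w q / 2)
    (hD : ∀ q, |(1 / (hh q) ^ 2 - 1 / (h q) ^ 2) / (1 / ee ^ 2 - 1 / e ^ 2)| ≤ M) (k : ℕ) :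
    (1 / (hh k) ^ 2 - 1 / (h k) ^ 2) / (1 / ee ^ 2 - 1 / e ^ 2)
      = (1 + (∑ p ∈ range k, (B (fun i => hh (p + 1 + i)) - B (fun i => h (p + 1 + i))
            - ∑' j, G (fun i => h (p + 1 + i)) j * (hh (p + 1 + j) - h (p + 1 + j)))) / (1 / ee ^ 2 - 1 / e ^ 2))
        - ∑ p ∈ range k, ∑' j, G (fun i => h (p + 1 + i)) j * (h (p + 1 + j) ^ 2 * hh (p + 1 + j) ^ 2 / (h (p + 1 + j) + hh (p + 1 + j)))
            * ((1 / (hh (p + 1 + j)) ^ 2 - 1 / (h (p + 1 + j)) ^ 2) / (1 / ee ^ 2 - 1 / e ^ 2)) := by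
  set δ : ℝ := 1 / ee ^ 2 - 1 / e ^ 2 with hδ
  have hc : ∀ p j, |G (fun i => h (p + 1 + i)) j| ≤ Cm * θ ^ j := fun p j => hG _ (seqBox_shift hhs (p + 1)) j
  -- summability of the linear rows
  have hsum : ∀ p, Summable fun j => G (fun i => h (p + 1 + i)) j * (h (p + 1 + j) ^ 2 * hh (p + 1 + j) ^ 2 / (h (p + 1 + j) + hh (p + 1 + j)))
      * ((1 / (hh (p + 1 + j)) ^ 2 - 1 / (h (p + 1 + j)) ^ 2) / δ) :=
    term_summable (v := fun q => h q ^ 2 * hh q ^ 2 / (h q + hh q)) (W := fun q => (1 / (hh q) ^ 2 - 1 / (h q) ^ 2) / δ)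
      hCm hθ0 hθ1 hwanti hc hμ hD
  -- termwise: h̃ − h = −δ · μ · D
  have hterm : ∀ q, hh q - h q = -δ * ((h q ^ 2 * hh q ^ 2 / (h q + hh q)) * ((1 / (hh q) ^ 2 - 1 / (h q) ^ 2) / δ)) := by
    intro q
    rw [sub_eq_mu_mul (hhs q).1 (hhhs q).1]
    field_simp
  -- the linear row equals −δ · (row of the quotients)
  have hrow : ∀ p, ∑' j, G (fun i => h (p + 1 + i)) j * (hh (p + 1 + j) - h (p + 1 + j))
      = -δ * ∑' j, G (fun i => h (p + 1 + i)) j * (h (p + 1 + j) ^ 2 * hh (p + 1 + j) ^ 2 / (h (p + 1 + j) + hh (p + 1 + j)))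
          * ((1 / (hh (p + 1 + j)) ^ 2 - 1 / (h (p + 1 + j)) ^ 2) / δ) := by
    intro p
    rw [← tsum_mul_left]
    exact tsum_congr fun j => by rw [hterm (p + 1 + j)]; ring
  -- the two flow equations subtracted
  have hflow : 1 / (hh k) ^ 2 - 1 / (h k) ^ 2 = δ + ∑ p ∈ range k, (B (fun i => hh (p + 1 + i)) - B (fun i => h (p + 1 + i))) := by
    rw [invSq_eq_of_memFlow hhhf k, invSq_eq_of_memFlow hhf k, hδ]
    unfold T4BetaFlowWellPosed.drive
    rw [Finset.sum_sub_distrib]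
    ring
  -- split each increment into linear part + remainder, substitute the linear rows
  have hsplit : ∑ p ∈ range k, (B (fun i => hh (p + 1 + i)) - B (fun i => h (p + 1 + i)))
      = ∑ p ∈ range k, (B (fun i => hh (p + 1 + i)) - B (fun i => h (p + 1 + i))
          - ∑' j, G (fun i => h (p + 1 + i)) j * (hh (p + 1 + j) - h (p + 1 + j)))
        + -δ * ∑ p ∈ range k, ∑' j, G (fun i => h (p + 1 + i)) j * (h (p + 1 + j) ^ 2 * hh (p + 1 + j) ^ 2 / (h (p + 1 + j) + hh (p + 1 + j)))
          * ((1 / (hh (p + 1 + j)) ^ 2 - 1 / (h (p + 1 + j)) ^ 2) / δ) := by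
    rw [Finset.mul_sum, ← Finset.sum_add_distrib]
    exact Finset.sum_congr rfl fun p _ => by rw [← hrow p]; ring
  rw [hflow, hsplit]
  field_simp
  ring

end

end Summit.QuantumFields.BalabanUV.Beta.EriceFlowEnclosureB12AsPrintedHistoryContagionShiftFlowZeroTangentFlow
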